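import Summits.ABC.StewartYu.ArchG3RecLinesHCore
import HarnessLib

/-!
# The archimedean record `ArchG3Rec` — letter lines in closed form, H family (half step): CORE BOUNDS, file C

Support file (theorems only; no named facts). Cell `abc-stewartyu`, route `YuMatveevShapeRat`, crux r2 `ArchCoreRat` (stmt-ABC-20502),
line `arch-g3-frame`, seam (B) of `stub_recLinesArch`, plan R50 (the half-step family `HalfStepLinesK (2^(n−1)) c lev` is seat p5's).
Continuation of `ArchG3RecLinesHCore` (currency `X·L`):
* `cb_logs_le` / `small_prod_le` (the `U0`-killed logarithms `log 2 + log(LbRK+1) + log(m+1) ≤ XL/2^16` and the smallness products);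
* `Tsucc_le` (`Tf (lev+1) 0 ≤ (τ + 3/4)(n+1)L` if `T lev ≤ τL`), `Tcost_le` (every `T′`-cost against `σ(n+1)L`);
* `log_kappa_le` (`log(2^{n−1}n) ≤ 1.7n`), `rho_succ_bounds` (the radii with one unit of room).

## References
* [Nesterenko2003] Yu. V. Nesterenko, LNM 1819 (2003) — §4 (4.3)–(4.5), §4.3 (4.36)–(4.51); shape only.
-/

noncomputable section

open Finset Real
open scoped Nat

namespace Summit.ABC.StewartYu

namespace ArchG3Rec

open PadicG3Par (Cb Cb_pos)
open ArchG3Par (G K yloadK G_eq G_pos K_pos yloadK_pos eight_le_G one_le_K)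

variable {n : ℕ} (P : ArchG3Rec n)

/-! ### The `U0`-killed logarithms and the smallness products -/

set_option maxHeartbeats 400000 in
/-- the logarithms of the comparison constant are sub-unit: `log 2 + log(LbRK lev jl + 1) + log(m + 1) ≤ X·L/2^16` for every
`0 ≤ m ≤ 2^lev·2^{n+6}·e^G·X` and `lev ≤ Ŝ` (`LbRK ≤ 4·(2^{n−1}n)·N·L`, `log N ≤ WN ≤ X/8`, `log L ≤ L/2^21`, `lev·log 2 ≤ Ŝ log 2 ≤ 10n+29+log N`).
[folklore] -/
theorem cb_logs_le (hn2 : 2 ≤ n) {lev : ℕ} (hlev : lev ≤ P.Sd) {m : ℝ} (hm0 : 0 ≤ m) (hm : m ≤ 2 ^ lev * (2 : ℝ) ^ (n + 6) * Real.exp (G n) * P.X) :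
    Real.log 2 + Real.log ((P.LbRK (2 ^ (n - 1)) lev P.jl : ℝ) + 1) + Real.log (m + 1) ≤ (P.X : ℝ) * P.L / 2 ^ 16 := by
  have hκ : 1 ≤ 2 ^ (n - 1) := Nat.one_le_two_pow
  obtain ⟨-, -, hLb, hLb0⟩ := P.LbRK_le (2 ^ (n - 1)) hκ lev P.jl
  obtain ⟨hlogL, hlogX, hlogN, -, -⟩ := P.log_letters_le
  obtain ⟨-, hSd⟩ := P.Sd_log_le
  have hX : (64 : ℝ) * (n + 1) ≤ P.X := by exact_mod_cast P.X_floors.1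
  have hX128 : (128 : ℝ) ≤ P.X := P.X_floors.2.1
  have hX8 := P.eight_WN_le_X
  have hWN := P.WN_bounds
  have hN := P.N_facts
  have hn : (2 : ℝ) ≤ n := by exact_mod_cast hn2
  have hL : (2 : ℝ) ^ 27 ≤ P.L :=
    calc (2 : ℝ) ^ 27 ≤ 2 ^ (n + 25) := pow_le_pow_right₀ (by norm_num) (by omega)
      _ ≤ P.L := P.L_real.2.2.1
  have hL0 : (0 : ℝ) < P.L := by linarith
  have hX0 : (0 : ℝ) < P.X := by linarith
  have hn0 : (0 : ℝ) < n := by linarith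
  have hl2 := Real.log_two_lt_d9
  have hl2p : 0 < Real.log 2 := Real.log_pos one_lt_two
  have hG : G n = 8 * (n + 1) := G_eq n
  have hκR : ((2 ^ (n - 1) : ℕ) : ℝ) = 2 ^ (n - 1) := by push_cast; ring
  have hκle : (2 : ℝ) ^ (n - 1) ≤ 2 ^ n := pow_le_pow_right₀ (by norm_num) (Nat.sub_le n 1)
  -- `LbRK + 1 ≤ 2^{n+3}·n·(N·L)`
  have hNL : (1 : ℝ) ≤ P.N * P.L := by nlinarith [hN.2.1, P.L_real.1]
  have h2n : (1 : ℝ) ≤ 2 ^ n := one_le_pow₀ (by norm_num)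
  have h1 : (P.LbRK (2 ^ (n - 1)) lev P.jl : ℝ) + 1 ≤ 2 ^ (n + 3) * n * (P.N * P.L) := by
    rw [hκR] at hLb
    have hp3 : (2 : ℝ) ^ (n + 3) = 8 * 2 ^ n := by rw [pow_add]; ring
    rw [hp3]
    have hA : 2 ^ (n - 1) * (n : ℝ) ≤ 2 ^ n * (n : ℝ) := mul_le_mul_of_nonneg_right hκle hn0.le
    have hA' := mul_le_mul_of_nonneg_right hA (by positivity : (0:ℝ) ≤ 4 * (P.N * P.L))
    have hB : (1 : ℝ) ≤ 2 ^ n * (n : ℝ) * (P.N * P.L) := by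
      have h' := mul_le_mul h2n (by linarith : (1:ℝ) ≤ n) zero_le_one (by positivity)
      have h'' := mul_le_mul h' hNL zero_le_one (by positivity)
      linarith
    nlinarith
  have h2 : Real.log ((P.LbRK (2 ^ (n - 1)) lev P.jl : ℝ) + 1) ≤ (n + 3) * Real.log 2 + (n - 1) + P.WN + P.L / 2 ^ 21 := by
    have hpos : (0 : ℝ) < (P.LbRK (2 ^ (n - 1)) lev P.jl : ℝ) + 1 := by linarith
    have e1 : Real.log (2 ^ (n + 3) * n * (P.N * P.L)) = (n + 3) * Real.log 2 + Real.log n + (Real.log P.N + Real.log P.L) := by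
      rw [Real.log_mul (by positivity) (mul_pos hN.1 hL0).ne', Real.log_mul (by positivity) hn0.ne',
        Real.log_mul hN.1.ne' hL0.ne', Real.log_pow]; push_cast; ring
    have hlogn := Real.log_le_sub_one_of_pos hn0
    calc Real.log ((P.LbRK (2 ^ (n - 1)) lev P.jl : ℝ) + 1) ≤ Real.log (2 ^ (n + 3) * n * (P.N * P.L)) := Real.log_le_log hpos h1
      _ ≤ (n + 3) * Real.log 2 + (n - 1) + P.WN + P.L / 2 ^ 21 := by rw [e1]; linarith
  -- `log(m+1) ≤ log(2B)`, `B = 2^lev·2^{n+6}·e^G·X ≥ 1`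
  have hG1 : (1 : ℝ) ≤ Real.exp (G n) := Real.one_le_exp (G_pos n).le
  have h2l : (1 : ℝ) ≤ 2 ^ lev := one_le_pow₀ (by norm_num)
  have h26 : (1 : ℝ) ≤ 2 ^ (n + 6) := one_le_pow₀ (by norm_num)
  have hB1 : (1 : ℝ) ≤ 2 ^ lev * (2 : ℝ) ^ (n + 6) * Real.exp (G n) * P.X :=
    one_le_mul_of_one_le_of_one_le (one_le_mul_of_one_le_of_one_le (one_le_mul_of_one_le_of_one_le h2l h26) hG1) (by linarith)
  have h3 : m + 1 ≤ 2 * (2 ^ lev * (2 : ℝ) ^ (n + 6) * Real.exp (G n) * P.X) := by linarith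
  have e2 : Real.log (2 * (2 ^ lev * (2 : ℝ) ^ (n + 6) * Real.exp (G n) * P.X)) =
      Real.log 2 + (lev * Real.log 2 + (n + 6) * Real.log 2 + G n + Real.log P.X) := by
    have hne1 : (2 : ℝ) ^ lev * 2 ^ (n + 6) ≠ 0 := by positivity
    have hne2 : (2 : ℝ) ^ lev * 2 ^ (n + 6) * Real.exp (G n) ≠ 0 := by positivity
    rw [Real.log_mul two_ne_zero (by positivity), Real.log_mul hne2 hX0.ne', Real.log_mul hne1 (Real.exp_pos _).ne',
      Real.log_mul (by positivity) (by positivity), Real.log_pow, Real.log_pow, Real.log_exp]; push_cast; ring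
  have h4 : Real.log (m + 1) ≤ Real.log 2 + (lev * Real.log 2 + (n + 6) * Real.log 2 + G n + P.X) := by
    calc Real.log (m + 1) ≤ Real.log (2 * (2 ^ lev * (2 : ℝ) ^ (n + 6) * Real.exp (G n) * P.X)) := Real.log_le_log (by linarith) h3
      _ ≤ Real.log 2 + (lev * Real.log 2 + (n + 6) * Real.log 2 + G n + P.X) := by rw [e2]; linarith
  have h5 : (lev : ℝ) * Real.log 2 ≤ 10 * n + 29 + Real.log P.N := by
    have h' : (lev : ℝ) ≤ P.Sd := by exact_mod_cast hlev
    have := mul_le_mul_of_nonneg_right h' hl2p.le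
    linarith
  have h8 : (n : ℝ) * Real.log 2 ≤ n := by
    have := mul_le_mul_of_nonneg_left (hl2.le.trans (by norm_num : (0.6931471808 : ℝ) ≤ 1)) hn0.le
    linarith
  -- everything is `≤ 3X + L/2^21 ≤ XL/2^16`
  rw [hG] at h4
  have h6 : Real.log 2 + ((n + 3) * Real.log 2 + (n - 1) + P.WN + P.L / 2 ^ 21) +
      (Real.log 2 + (lev * Real.log 2 + (n + 6) * Real.log 2 + 8 * (n + 1) + P.X)) ≤ 3 * P.X + P.L / 2 ^ 21 := by
    linarith
  have h7 : 3 * (P.X : ℝ) + P.L / 2 ^ 21 ≤ (P.X : ℝ) * P.L / 2 ^ 16 := by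
    rw [le_div_iff₀ (by positivity)]; nlinarith
  linarith

/-- **the smallness products of the half step**: for `U0 c ≥ X·L/2^16` (e.g. `c ≥ 2^63`) and `0 ≤ m` with
`m + 1 ≤ 2^lev·2^{n+6}·e^G·X`, `LbRK·δR·m ≤ 1`. [folklore] -/
theorem small_prod_le (hn2 : 2 ≤ n) {lev : ℕ} (hlev : lev ≤ P.Sd) {c : ℝ} (hU : (P.X : ℝ) * P.L / 2 ^ 16 ≤ P.U0 c)
    {m : ℝ} (hm0 : 0 ≤ m) (hm : m + 1 ≤ 2 ^ lev * (2 : ℝ) ^ (n + 6) * Real.exp (G n) * P.X) :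
    (P.LbRK (2 ^ (n - 1)) lev P.jl : ℝ) * P.δR c * m ≤ 1 := by
  have hκ : 1 ≤ 2 ^ (n - 1) := Nat.one_le_two_pow
  have hLb0 := (P.LbRK_le (2 ^ (n - 1)) hκ lev P.jl).2.2.2
  have hlogs := P.cb_logs_le hn2 hlev hm0 (by linarith)
  have hl2p : 0 < Real.log 2 := Real.log_pos one_lt_two
  -- `LbRK·m ≤ (LbRK+1)(m+1) = exp(log(LbRK+1) + log(m+1)) ≤ exp(XL/2^16) ≤ exp(U0)`
  have h1 : (P.LbRK (2 ^ (n - 1)) lev P.jl : ℝ) * m ≤ Real.exp (P.U0 c) := by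
    have h2 : (P.LbRK (2 ^ (n - 1)) lev P.jl : ℝ) * m ≤ ((P.LbRK (2 ^ (n - 1)) lev P.jl : ℝ) + 1) * (m + 1) := by nlinarith
    have h3 : ((P.LbRK (2 ^ (n - 1)) lev P.jl : ℝ) + 1) * (m + 1) =
        Real.exp (Real.log ((P.LbRK (2 ^ (n - 1)) lev P.jl : ℝ) + 1) + Real.log (m + 1)) := by
      rw [Real.exp_add, Real.exp_log (by linarith), Real.exp_log (by linarith)]
    rw [h3] at h2
    exact h2.trans (Real.exp_le_exp.mpr (by linarith))
  have hδ : P.δR c = Real.exp (-P.U0 c) := by unfold δR; rfl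
  rw [hδ, mul_right_comm, Real.exp_neg, mul_inv_le_iff₀ (Real.exp_pos _), one_mul]
  exact h1

/-! ### Every `T′`-cost of the half step -/

/-- **the order of the next level against the drop of this one**: `T lev ≤ τ·L` ⇒ `Tf (lev+1) 0 ≤ (τ + 3/4)(n+1)L`
(`M/(n+2)³ ≤ (n+1)L/4`, `2Ŝ + 2 ≤ L/2`). [cite: Nesterenko2003, (4.5); shape only] -/
theorem Tsucc_le (hn2 : 2 ≤ n) {lev : ℕ} (hlev : lev < P.Sd) {τ : ℝ} (hT : (P.T lev : ℝ) ≤ τ * P.L) :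
    (P.Tf (lev + 1) 0 : ℝ) ≤ (τ + 3 / 4) * (((n : ℝ) + 1) * P.L) ∧ (0 : ℝ) ≤ P.Tf (lev + 1) 0 := by
  have h0 := P.Tf_succ_zero_real_le lev hlev
  have hSdL := P.Sd_real_le_L
  have hL := P.L_real.2.1
  have hn : (2 : ℝ) ≤ n := by exact_mod_cast hn2
  refine ⟨?_, Nat.cast_nonneg _⟩
  have hcube : (64 : ℝ) ≤ ((n : ℝ) + 2) ^ 3 :=
    calc (64 : ℝ) = 4 ^ 3 := by norm_num
      _ ≤ ((n : ℝ) + 2) ^ 3 := pow_le_pow_left₀ (by norm_num) (by linarith) 3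
  have hQ0 : (0 : ℝ) ≤ ((n : ℝ) + 1) * P.L := by positivity
  have h1 : 16 * ((n : ℝ) + 1) * P.L / ((n : ℝ) + 2) ^ 3 ≤ ((n : ℝ) + 1) * P.L / 4 := by
    rw [div_le_div_iff₀ (by positivity) (by norm_num)]
    have := mul_le_mul_of_nonneg_left hcube hQ0
    nlinarith
  have h2 : ((n : ℝ) + 1) * (P.T lev + 2 * P.Sd + 2) ≤ ((n : ℝ) + 1) * (τ * P.L + P.L / 2) :=
    mul_le_mul_of_nonneg_left (by linarith) (by positivity)
  nlinarith

/-- **every `T′ = Tf (lev+1) 0`-cost of the half step**, given `T′ ≤ σ(n+1)L`: `T′·X ≤ σ(n+1)XL`, `T′·(n+1) ≤ σ(n+1)XL/64`,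
`T′ ≤ σXL/64`, `T′·WN ≤ σZ/64`, `T′·log N ≤ σZ/64`, `T′·(Ŝ log 2) ≤ σ(10(n+1)XL + 19XL)/64 + σZ/64`, `T′·H ≤ σ(n+1)XL/8`
(`n+1 ≤ X/64`, `(n+1)L·WN ≤ Z/64`, `Ŝ log 2 ≤ 10n + 29 + log N`, `H ≤ X/8`). [cite: Nesterenko2003, (4.5); shape only] -/
theorem Tcost_le {T' σ : ℝ} (hT0 : 0 ≤ T') (hσ0 : 0 ≤ σ) (hmain : T' ≤ σ * (((n : ℝ) + 1) * P.L)) :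
    T' * P.X ≤ σ * (((n : ℝ) + 1) * ((P.X : ℝ) * P.L)) ∧
    T' * ((n : ℝ) + 1) ≤ σ * (((n : ℝ) + 1) * ((P.X : ℝ) * P.L)) / 64 ∧
    T' ≤ σ * ((P.X : ℝ) * P.L) / 64 ∧
    T' * P.WN ≤ σ * P.Z / 64 ∧
    T' * Real.log P.N ≤ σ * P.Z / 64 ∧
    T' * (P.Sd * Real.log 2) ≤ σ * (10 * (((n : ℝ) + 1) * ((P.X : ℝ) * P.L)) + 19 * ((P.X : ℝ) * P.L)) / 64 + σ * P.Z / 64 ∧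
    T' * P.H ≤ σ * (((n : ℝ) + 1) * ((P.X : ℝ) * P.L)) / 8 := by
  obtain ⟨-, hSd⟩ := P.Sd_log_le
  obtain ⟨hZ0, hZW, -, -⟩ := P.Z_floors
  obtain ⟨-, hHle, -⟩ := P.H_bounds
  have hG : G n = 8 * (n + 1) := G_eq n
  have hX : (64 : ℝ) * (n + 1) ≤ P.X := by exact_mod_cast P.X_floors.1
  have hL := P.L_real.2.1
  have hWN := P.WN_bounds
  have hn0 : (0 : ℝ) ≤ n := Nat.cast_nonneg n
  have hQ0 : (0 : ℝ) ≤ ((n : ℝ) + 1) * P.L := by positivity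
  set Q : ℝ := ((n : ℝ) + 1) * P.L with hQ
  set XL : ℝ := (P.X : ℝ) * P.L with hXL
  -- the unit facts about `Q = (n+1)L`
  have uX : Q * P.X = ((n : ℝ) + 1) * XL := by rw [hQ, hXL]; ring
  have un : Q * ((n : ℝ) + 1) ≤ ((n : ℝ) + 1) * XL / 64 := by
    rw [hQ, hXL, le_div_iff₀ (by norm_num)]
    have := mul_le_mul_of_nonneg_left hX hQ0
    nlinarith
  have u1 : Q ≤ XL / 64 := by
    rw [hQ, hXL, le_div_iff₀ (by norm_num)]; nlinarith
  have uW : Q * P.WN ≤ P.Z / 64 := by rw [hQ, le_div_iff₀ (by norm_num)]; nlinarith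
  have uN : Q * Real.log P.N ≤ P.Z / 64 := (mul_le_mul_of_nonneg_left hWN.2.2.1 hQ0).trans uW
  have uS : Q * (10 * (n : ℝ) + 29) ≤ (10 * (((n : ℝ) + 1) * XL) + 19 * XL) / 64 := by
    have e : Q * (10 * (n : ℝ) + 29) = 10 * (Q * ((n : ℝ) + 1)) + 19 * Q := by ring
    rw [e]; linarith
  have uH : (P.H : ℝ) ≤ P.X / 8 := by
    rw [hG] at hHle
    have : (8 : ℝ) * (n + 1) * P.X / (64 * (n + 1)) = P.X / 8 := by field_simp; ring
    linarith [this]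
  -- scale by `T' ≤ σ Q`
  have sX := mul_le_mul_of_nonneg_right hmain (by positivity : (0 : ℝ) ≤ P.X)
  have sn := mul_le_mul_of_nonneg_right hmain (by positivity : (0 : ℝ) ≤ (n : ℝ) + 1)
  have sW := mul_le_mul_of_nonneg_right hmain hWN.2.2.2.le
  have sN := mul_le_mul_of_nonneg_right hmain P.N_facts.2.2
  have sS := mul_le_mul_of_nonneg_right hmain (by positivity : (0 : ℝ) ≤ 10 * (n : ℝ) + 29)
  have sH := mul_le_mul hmain uH (by positivity) (by positivity)
  refine ⟨?_, ?_, ?_, ?_, ?_, ?_, ?_⟩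
  · calc T' * P.X ≤ σ * Q * P.X := sX
      _ = σ * (((n : ℝ) + 1) * XL) := by rw [mul_assoc, uX]
  · calc T' * ((n : ℝ) + 1) ≤ σ * Q * ((n : ℝ) + 1) := sn
      _ = σ * (Q * ((n : ℝ) + 1)) := by ring
      _ ≤ σ * (((n : ℝ) + 1) * XL / 64) := mul_le_mul_of_nonneg_left un hσ0
      _ = σ * (((n : ℝ) + 1) * XL) / 64 := by ring
  · calc T' ≤ σ * Q := hmain
      _ ≤ σ * (XL / 64) := mul_le_mul_of_nonneg_left u1 hσ0
      _ = σ * XL / 64 := by ring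
  · calc T' * P.WN ≤ σ * Q * P.WN := sW
      _ = σ * (Q * P.WN) := by ring
      _ ≤ σ * (P.Z / 64) := mul_le_mul_of_nonneg_left uW hσ0
      _ = σ * P.Z / 64 := by ring
  · calc T' * Real.log P.N ≤ σ * Q * Real.log P.N := sN
      _ = σ * (Q * Real.log P.N) := by ring
      _ ≤ σ * (P.Z / 64) := mul_le_mul_of_nonneg_left uN hσ0
      _ = σ * P.Z / 64 := by ring
  · have h2 : T' * (P.Sd * Real.log 2) ≤ T' * (10 * n + 29) + T' * Real.log P.N := by
      have := mul_le_mul_of_nonneg_left hSd hT0; rw [mul_add] at this; exact this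
    have h3 : T' * (10 * (n : ℝ) + 29) ≤ σ * ((10 * (((n : ℝ) + 1) * XL) + 19 * XL) / 64) :=
      calc T' * (10 * (n : ℝ) + 29) ≤ σ * Q * (10 * n + 29) := sS
        _ = σ * (Q * (10 * n + 29)) := by ring
        _ ≤ σ * ((10 * (((n : ℝ) + 1) * XL) + 19 * XL) / 64) := mul_le_mul_of_nonneg_left uS hσ0
    have h4 : T' * Real.log P.N ≤ σ * (P.Z / 64) :=
      calc T' * Real.log P.N ≤ σ * Q * Real.log P.N := sN
        _ = σ * (Q * Real.log P.N) := by ring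
        _ ≤ σ * (P.Z / 64) := mul_le_mul_of_nonneg_left uN hσ0
    have e1 : σ * ((10 * (((n : ℝ) + 1) * XL) + 19 * XL) / 64) = σ * (10 * (((n : ℝ) + 1) * XL) + 19 * XL) / 64 := by ring
    have e2 : σ * (P.Z / 64) = σ * P.Z / 64 := by ring
    linarith
  · calc T' * P.H ≤ σ * Q * (P.X / 8) := sH
      _ = σ * (Q * P.X) / 8 := by ring
      _ = σ * (((n : ℝ) + 1) * XL) / 8 := by rw [uX]

/-! ### Two more letters -/

/-- the adjugate letter of the shaped frame in logarithm: `log(2^{n−1}·n) ≤ (17/10)·n`, `0 ≤ log(2^{n−1}·n)`. [folklore] -/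
theorem log_kappa_le (hn : 1 ≤ n) :
    Real.log (((2 ^ (n - 1) : ℕ) : ℝ) * n) ≤ 17 / 10 * n ∧ 0 ≤ Real.log (((2 ^ (n - 1) : ℕ) : ℝ) * n) := by
  obtain ⟨-, -, h1⟩ := ArchG3Rec.kappa_pred_le (κ := 2 ^ (n - 1)) (n := n) Nat.one_le_two_pow hn
  have hn1 : (1 : ℝ) ≤ n := by exact_mod_cast hn
  have hn0 : (0 : ℝ) < n := by linarith
  have hl2 := Real.log_two_lt_d9
  have hκR : ((2 ^ (n - 1) : ℕ) : ℝ) = 2 ^ (n - 1) := by push_cast; ring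
  refine ⟨?_, Real.log_nonneg h1⟩
  rw [hκR, Real.log_mul (by positivity) hn0.ne', Real.log_pow]
  have hsub : ((n - 1 : ℕ) : ℝ) = n - 1 := by rw [Nat.cast_sub hn]; push_cast; ring
  rw [hsub]
  have hlogn := Real.log_le_sub_one_of_pos hn0
  nlinarith

/-- the radii of the half step with one unit of room (for the `U0`-killed logarithms and the smallness products):
`3Nf+3`, `ρ_F + 1`, `Nf + 1 ≤ 2^lev·2^{n+6}·e^G·X`. [cite: Nesterenko2003, §4.3 (4.44); shape only] -/
theorem rho_succ_bounds (lev : ℕ) :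
    3 * (P.Nf lev n : ℝ) + 2 + 1 ≤ 2 ^ lev * (2 : ℝ) ^ (n + 6) * Real.exp (G n) * P.X ∧
    (3 * Real.exp (G n) + 1) * (2 * (P.Nf lev n : ℝ) + 1) + P.Nf lev n + 1 ≤ 2 ^ lev * (2 : ℝ) ^ (n + 6) * Real.exp (G n) * P.X ∧
    (P.Nf lev n : ℝ) + 1 ≤ 2 ^ lev * (2 : ℝ) ^ (n + 6) * Real.exp (G n) * P.X := by
  obtain ⟨-, hNf, -, -, -⟩ := P.nodes_le lev n
  have hX : (128 : ℝ) ≤ P.X := P.X_floors.2.1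
  have hG1 : (1 : ℝ) ≤ Real.exp (G n) := Real.one_le_exp (G_pos n).le
  have hNf0 : (0 : ℝ) ≤ P.Nf lev n := Nat.cast_nonneg _
  have hpow : (2 : ℝ) ^ (n + lev) = 2 ^ n * 2 ^ lev := pow_add 2 n lev
  have hpow6 : (2 : ℝ) ^ (n + 6) = 2 ^ n * 64 := by rw [pow_add]; norm_num
  have h2n : (1 : ℝ) ≤ 2 ^ n := one_le_pow₀ (by norm_num)
  have h2l : (1 : ℝ) ≤ 2 ^ lev := one_le_pow₀ (by norm_num)
  set M : ℝ := 2 ^ (n + lev) * P.X with hM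
  have hM1 : (128 : ℝ) ≤ M := by
    rw [hM, hpow]; nlinarith [mul_le_mul h2n h2l zero_le_one (by positivity)]
  have hB : 2 ^ lev * (2 : ℝ) ^ (n + 6) * Real.exp (G n) * P.X = 64 * Real.exp (G n) * M := by rw [hM, hpow, hpow6]; ring
  rw [hB]
  have hM0 : 0 ≤ M := by linarith
  have hEM : M ≤ Real.exp (G n) * M := by nlinarith
  refine ⟨by nlinarith, ?_, by nlinarith⟩
  have h1 : (3 * Real.exp (G n) + 1) * (2 * (P.Nf lev n : ℝ) + 1) ≤ (3 * Real.exp (G n) + 1) * (3 * M) :=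
    mul_le_mul_of_nonneg_left (by linarith) (by positivity)
  nlinarith

end ArchG3Rec

end Summit.ABC.StewartYu

end
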